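import Literature.Computability.FineGrained.IPRenameDepLists
import HarnessLib

/-!
# The renaming machine of Impagliazzo–Paturi's Lemma 2, IX: driving the emission loops over the clauses and the blocks

Family `fine-grained` (trunk T-CPLX-FINE). Ninth file of the machine half of Impagliazzo–Paturi's Lemma 2: the two drivers that, given the
annotated clause list `wAC P F` in `ac` and the tables of `P`, `F` in `bt`, `yt`, emit ALL clauses
of the reduced formula `IPRename.reduce P φ` — `outClauses P F` of `ForcedVariableRenaming.lean`.

* Invariance of the base hypotheses (`KBase`, `ScanClean`, `ThetaClean`) under the drivers' own
  registers (`upd_*`);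
* `clauseStep` / `cdBody` / `clauseDrive` / **`runs_clauseDrive`** — over a copy of `ac`: stage the
  symbols of a clause in `c2`, at its closing blank move it to `cl`, build its dependency list
  (`vBuild`), arm and run `cnfLoop evalClause` (`runs_cnfLoop_gClause`), clean up; the accumulator
  receives `wFam (F.flatMap fun c => cnf (gClause P F c) (depClause P F c))` (costs `clauseCost`,
  `cnfCost`);
* `thetaStep` / `tdBody` / `thetaDrive` / **`runs_thetaDrive`** — over a copy of the block table
  (in the spare register `s0`), at the closing blank of block `i` (counted in `iu`): dependency
  list by `vEmitBlock`, `cnfLoop thetaEval` (`runs_cnfLoop_theta`); the accumulator receives the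
  slice constraints of the nonempty blocks, which are all of them
  (`flatMap_theta_range_numBlocks`: empty blocks contribute no clause);
* `emitOut` / **`runs_emitOut`** — both in sequence: the accumulator receives
  `wFam (outClauses P F)` reversed (cost `emitOutCost P F`), every other register is restored.
  What remains for the machine is to put the tables, the annotated clauses and the header of each
  disjunct in place and to loop over masks, `f`-vectors and input formulas.

## References

* R. Impagliazzo, R. Paturi, *On the complexity of k-SAT*, J. Comput. System Sci. 62 (2001)
  367–375, doi:10.1006/jcss.2000.1727, Lemma 2 (p. 373) and its "Moreover" sentence (the
  reduction is computable within the stated time); pp. 371–372 (`G_x`, `Ψ`, `Θ_i`, `Φ_f`).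
  (Not held; acquisition request acq-00143.)
* T. Nipkow, G. Klein, *Concrete Semantics with Isabelle/HOL*, Springer 2014, Ch. 7 (big-step
  reasoning about loops, as in `SymbolPrograms.lean`).
-/

namespace Literature.Computability.FineGrained.IPRenameM

open _root_.Computability Complexity Complexity.ACom Sparsifier IPRename

/-! ### Driving the emission loops over the clauses and the blocks: invariance of the base -/

/-- `KBase` survives an update of `ac2`. [folklore] -/
theorem KBase.upd_ac2 {T : AStore Γ' KR} {zsss : List (List (List Entry))} {t : List (ℕ × List ℕ)} (h : KBase T zsss t) (u : List Γ') : KBase (Function.update T KR.ac2 u) zsss t :=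
  { vw := by rw [Function.update_of_ne (by decide)]; exact h.vw, fnd := by rw [Function.update_of_ne (by decide)]; exact h.fnd, ex := by rw [Function.update_of_ne (by decide)]; exact h.ex, eb := by rw [Function.update_of_ne (by decide)]; exact h.eb, lmd := by rw [Function.update_of_ne (by decide)]; exact h.lmd, ne := by rw [Function.update_of_ne (by decide)]; exact h.ne, x2 := by rw [Function.update_of_ne (by decide)]; exact h.x2, t1 := by rw [Function.update_of_ne (by decide)]; exact h.t1, t2 := by rw [Function.update_of_ne (by decide)]; exact h.t2, btw := by rw [Function.update_of_ne (by decide)]; exact h.btw, md2 := by rw [Function.update_of_ne (by decide)]; exact h.md2, pt := by rw [Function.update_of_ne (by decide)]; exact h.pt, pf := by rw [Function.update_of_ne (by decide)]; exact h.pf, lpol := by rw [Function.update_of_ne (by decide)]; exact h.lpol, allf := by rw [Function.update_of_ne (by decide)]; exact h.allf, ft := by rw [Function.update_of_ne (by decide)]; exact h.ft, ff := by rw [Function.update_of_ne (by decide)]; exact h.ff, gt := by rw [Function.update_of_ne (by decide)]; exact h.gt, gf := by rw [Function.update_of_ne (by decide)]; exact h.gf, done := by rw [Function.update_of_ne (by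 decide)]; exact h.done, ru := by rw [Function.update_of_ne (by decide)]; exact h.ru, cntf := by rw [Function.update_of_ne (by decide)]; exact h.cntf, ytw := by rw [Function.update_of_ne (by decide)]; exact h.ytw, yv := by rw [Function.update_of_ne (by decide)]; exact h.yv, bt := by rw [Function.update_of_ne (by decide)]; exact h.bt, yt := by rw [Function.update_of_ne (by decide)]; exact h.yt }

/-- `KBase` survives an update of `c2`. [folklore] -/
theorem KBase.upd_c2 {T : AStore Γ' KR} {zsss : List (List (List Entry))} {t : List (ℕ × List ℕ)} (h : KBase T zsss t) (u : List Γ') : KBase (Function.update T KR.c2 u) zsss t :=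
  { vw := by rw [Function.update_of_ne (by decide)]; exact h.vw, fnd := by rw [Function.update_of_ne (by decide)]; exact h.fnd, ex := by rw [Function.update_of_ne (by decide)]; exact h.ex, eb := by rw [Function.update_of_ne (by decide)]; exact h.eb, lmd := by rw [Function.update_of_ne (by decide)]; exact h.lmd, ne := by rw [Function.update_of_ne (by decide)]; exact h.ne, x2 := by rw [Function.update_of_ne (by decide)]; exact h.x2, t1 := by rw [Function.update_of_ne (by decide)]; exact h.t1, t2 := by rw [Function.update_of_ne (by decide)]; exact h.t2, btw := by rw [Function.update_of_ne (by decide)]; exact h.btw, md2 := by rw [Function.update_of_ne (by decide)]; exact h.md2, pt := by rw [Function.update_of_ne (by decide)]; exact h.pt, pf := by rw [Function.update_of_ne (by decide)]; exact h.pf, lpol := by rw [Function.update_of_ne (by decide)]; exact h.lpol, allf := by rw [Function.update_of_ne (by decide)]; exact h.allf, ft := by rw [Function.update_of_ne (by decide)]; exact h.ft, ff := by rw [Function.update_of_ne (by decide)]; exact h.ff, gt := by rw [Function.update_of_ne (by decide)]; exact h.gt, gf := by rw [Function.update_of_ne (by decide)]; exact h.gf, done := by rw [Function.update_of_ne (by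 decide)]; exact h.done, ru := by rw [Function.update_of_ne (by decide)]; exact h.ru, cntf := by rw [Function.update_of_ne (by decide)]; exact h.cntf, ytw := by rw [Function.update_of_ne (by decide)]; exact h.ytw, yv := by rw [Function.update_of_ne (by decide)]; exact h.yv, bt := by rw [Function.update_of_ne (by decide)]; exact h.bt, yt := by rw [Function.update_of_ne (by decide)]; exact h.yt }

/-- `KBase` survives an update of `cl`. [folklore] -/
theorem KBase.upd_cl {T : AStore Γ' KR} {zsss : List (List (List Entry))} {t : List (ℕ × List ℕ)} (h : KBase T zsss t) (u : List Γ') : KBase (Function.update T KR.cl u) zsss t :=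
  { vw := by rw [Function.update_of_ne (by decide)]; exact h.vw, fnd := by rw [Function.update_of_ne (by decide)]; exact h.fnd, ex := by rw [Function.update_of_ne (by decide)]; exact h.ex, eb := by rw [Function.update_of_ne (by decide)]; exact h.eb, lmd := by rw [Function.update_of_ne (by decide)]; exact h.lmd, ne := by rw [Function.update_of_ne (by decide)]; exact h.ne, x2 := by rw [Function.update_of_ne (by decide)]; exact h.x2, t1 := by rw [Function.update_of_ne (by decide)]; exact h.t1, t2 := by rw [Function.update_of_ne (by decide)]; exact h.t2, btw := by rw [Function.update_of_ne (by decide)]; exact h.btw, md2 := by rw [Function.update_of_ne (by decide)]; exact h.md2, pt := by rw [Function.update_of_ne (by decide)]; exact h.pt, pf := by rw [Function.update_of_ne (by decide)]; exact h.pf, lpol := by rw [Function.update_of_ne (by decide)]; exact h.lpol, allf := by rw [Function.update_of_ne (by decide)]; exact h.allf, ft := by rw [Function.update_of_ne (by decide)]; exact h.ft, ff := by rw [Function.update_of_ne (by decide)]; exact h.ff, gt := by rw [Function.update_of_ne (by decide)]; exact h.gt, gf := by rw [Function.update_of_ne (by decide)]; exact h.gf, done := by rw [Function.update_of_ne (by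 decide)]; exact h.done, ru := by rw [Function.update_of_ne (by decide)]; exact h.ru, cntf := by rw [Function.update_of_ne (by decide)]; exact h.cntf, ytw := by rw [Function.update_of_ne (by decide)]; exact h.ytw, yv := by rw [Function.update_of_ne (by decide)]; exact h.yv, bt := by rw [Function.update_of_ne (by decide)]; exact h.bt, yt := by rw [Function.update_of_ne (by decide)]; exact h.yt }

/-- `KBase` survives an update of `s0`. [folklore] -/
theorem KBase.upd_s0 {T : AStore Γ' KR} {zsss : List (List (List Entry))} {t : List (ℕ × List ℕ)} (h : KBase T zsss t) (u : List Γ') : KBase (Function.update T KR.s0 u) zsss t :=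
  { vw := by rw [Function.update_of_ne (by decide)]; exact h.vw, fnd := by rw [Function.update_of_ne (by decide)]; exact h.fnd, ex := by rw [Function.update_of_ne (by decide)]; exact h.ex, eb := by rw [Function.update_of_ne (by decide)]; exact h.eb, lmd := by rw [Function.update_of_ne (by decide)]; exact h.lmd, ne := by rw [Function.update_of_ne (by decide)]; exact h.ne, x2 := by rw [Function.update_of_ne (by decide)]; exact h.x2, t1 := by rw [Function.update_of_ne (by decide)]; exact h.t1, t2 := by rw [Function.update_of_ne (by decide)]; exact h.t2, btw := by rw [Function.update_of_ne (by decide)]; exact h.btw, md2 := by rw [Function.update_of_ne (by decide)]; exact h.md2, pt := by rw [Function.update_of_ne (by decide)]; exact h.pt, pf := by rw [Function.update_of_ne (by decide)]; exact h.pf, lpol := by rw [Function.update_of_ne (by decide)]; exact h.lpol, allf := by rw [Function.update_of_ne (by decide)]; exact h.allf, ft := by rw [Function.update_of_ne (by decide)]; exact h.ft, ff := by rw [Function.update_of_ne (by decide)]; exact h.ff, gt := by rw [Function.update_of_ne (by decide)]; exact h.gt, gf := by rw [Function.update_of_ne (by decide)]; exact h.gf, done := by rw [Function.update_of_ne (by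 decide)]; exact h.done, ru := by rw [Function.update_of_ne (by decide)]; exact h.ru, cntf := by rw [Function.update_of_ne (by decide)]; exact h.cntf, ytw := by rw [Function.update_of_ne (by decide)]; exact h.ytw, yv := by rw [Function.update_of_ne (by decide)]; exact h.yv, bt := by rw [Function.update_of_ne (by decide)]; exact h.bt, yt := by rw [Function.update_of_ne (by decide)]; exact h.yt }

/-- `KBase` survives an update of `iu`. [folklore] -/
theorem KBase.upd_iu {T : AStore Γ' KR} {zsss : List (List (List Entry))} {t : List (ℕ × List ℕ)} (h : KBase T zsss t) (u : List Γ') : KBase (Function.update T KR.iu u) zsss t :=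
  { vw := by rw [Function.update_of_ne (by decide)]; exact h.vw, fnd := by rw [Function.update_of_ne (by decide)]; exact h.fnd, ex := by rw [Function.update_of_ne (by decide)]; exact h.ex, eb := by rw [Function.update_of_ne (by decide)]; exact h.eb, lmd := by rw [Function.update_of_ne (by decide)]; exact h.lmd, ne := by rw [Function.update_of_ne (by decide)]; exact h.ne, x2 := by rw [Function.update_of_ne (by decide)]; exact h.x2, t1 := by rw [Function.update_of_ne (by decide)]; exact h.t1, t2 := by rw [Function.update_of_ne (by decide)]; exact h.t2, btw := by rw [Function.update_of_ne (by decide)]; exact h.btw, md2 := by rw [Function.update_of_ne (by decide)]; exact h.md2, pt := by rw [Function.update_of_ne (by decide)]; exact h.pt, pf := by rw [Function.update_of_ne (by decide)]; exact h.pf, lpol := by rw [Function.update_of_ne (by decide)]; exact h.lpol, allf := by rw [Function.update_of_ne (by decide)]; exact h.allf, ft := by rw [Function.update_of_ne (by decide)]; exact h.ft, ff := by rw [Function.update_of_ne (by decide)]; exact h.ff, gt := by rw [Function.update_of_ne (by decide)]; exact h.gt, gf := by rw [Function.update_of_ne (by decide)]; exact h.gf, done := by rw [Function.update_of_ne (by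 decide)]; exact h.done, ru := by rw [Function.update_of_ne (by decide)]; exact h.ru, cntf := by rw [Function.update_of_ne (by decide)]; exact h.cntf, ytw := by rw [Function.update_of_ne (by decide)]; exact h.ytw, yv := by rw [Function.update_of_ne (by decide)]; exact h.yv, bt := by rw [Function.update_of_ne (by decide)]; exact h.bt, yt := by rw [Function.update_of_ne (by decide)]; exact h.yt }

/-- `KBase` survives an update of `blk`. [folklore] -/
theorem KBase.upd_blk {T : AStore Γ' KR} {zsss : List (List (List Entry))} {t : List (ℕ × List ℕ)} (h : KBase T zsss t) (u : List Γ') : KBase (Function.update T KR.blk u) zsss t :=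
  { vw := by rw [Function.update_of_ne (by decide)]; exact h.vw, fnd := by rw [Function.update_of_ne (by decide)]; exact h.fnd, ex := by rw [Function.update_of_ne (by decide)]; exact h.ex, eb := by rw [Function.update_of_ne (by decide)]; exact h.eb, lmd := by rw [Function.update_of_ne (by decide)]; exact h.lmd, ne := by rw [Function.update_of_ne (by decide)]; exact h.ne, x2 := by rw [Function.update_of_ne (by decide)]; exact h.x2, t1 := by rw [Function.update_of_ne (by decide)]; exact h.t1, t2 := by rw [Function.update_of_ne (by decide)]; exact h.t2, btw := by rw [Function.update_of_ne (by decide)]; exact h.btw, md2 := by rw [Function.update_of_ne (by decide)]; exact h.md2, pt := by rw [Function.update_of_ne (by decide)]; exact h.pt, pf := by rw [Function.update_of_ne (by decide)]; exact h.pf, lpol := by rw [Function.update_of_ne (by decide)]; exact h.lpol, allf := by rw [Function.update_of_ne (by decide)]; exact h.allf, ft := by rw [Function.update_of_ne (by decide)]; exact h.ft, ff := by rw [Function.update_of_ne (by decide)]; exact h.ff, gt := by rw [Function.update_of_ne (by decide)]; exact h.gt, gf := by rw [Function.update_of_ne (by decide)]; exact h.gf, done := by rw [Function.update_of_ne (by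 decide)]; exact h.done, ru := by rw [Function.update_of_ne (by decide)]; exact h.ru, cntf := by rw [Function.update_of_ne (by decide)]; exact h.cntf, ytw := by rw [Function.update_of_ne (by decide)]; exact h.ytw, yv := by rw [Function.update_of_ne (by decide)]; exact h.yv, bt := by rw [Function.update_of_ne (by decide)]; exact h.bt, yt := by rw [Function.update_of_ne (by decide)]; exact h.yt }

/-- `ScanClean` survives an update of `ac2`. [folklore] -/
theorem ScanClean.upd_ac2 {T : AStore Γ' KR} (h : ScanClean T) (u : List Γ') : ScanClean (Function.update T KR.ac2 u) :=
  { clw := by rw [Function.update_of_ne (by decide)]; exact h.clw, md := by rw [Function.update_of_ne (by decide)]; exact h.md, pol := by rw [Function.update_of_ne (by decide)]; exact h.pol, tag := by rw [Function.update_of_ne (by decide)]; exact h.tag, pr := by rw [Function.update_of_ne (by decide)]; exact h.pr, blk := by rw [Function.update_of_ne (by decide)]; exact h.blk, iu2 := by rw [Function.update_of_ne (by decide)]; exact h.iu2, pos := by rw [Function.update_of_ne (by decide)]; exact h.pos, res := by rw [Function.update_of_ne (by decide)]; exact h.res, val := by rw [Function.update_of_ne (by decide)]; exact h.val }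

/-- `ScanClean` survives an update of `c2`. [folklore] -/
theorem ScanClean.upd_c2 {T : AStore Γ' KR} (h : ScanClean T) (u : List Γ') : ScanClean (Function.update T KR.c2 u) :=
  { clw := by rw [Function.update_of_ne (by decide)]; exact h.clw, md := by rw [Function.update_of_ne (by decide)]; exact h.md, pol := by rw [Function.update_of_ne (by decide)]; exact h.pol, tag := by rw [Function.update_of_ne (by decide)]; exact h.tag, pr := by rw [Function.update_of_ne (by decide)]; exact h.pr, blk := by rw [Function.update_of_ne (by decide)]; exact h.blk, iu2 := by rw [Function.update_of_ne (by decide)]; exact h.iu2, pos := by rw [Function.update_of_ne (by decide)]; exact h.pos, res := by rw [Function.update_of_ne (by decide)]; exact h.res, val := by rw [Function.update_of_ne (by decide)]; exact h.val }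

/-- `ScanClean` survives an update of `cl`. [folklore] -/
theorem ScanClean.upd_cl {T : AStore Γ' KR} (h : ScanClean T) (u : List Γ') : ScanClean (Function.update T KR.cl u) :=
  { clw := by rw [Function.update_of_ne (by decide)]; exact h.clw, md := by rw [Function.update_of_ne (by decide)]; exact h.md, pol := by rw [Function.update_of_ne (by decide)]; exact h.pol, tag := by rw [Function.update_of_ne (by decide)]; exact h.tag, pr := by rw [Function.update_of_ne (by decide)]; exact h.pr, blk := by rw [Function.update_of_ne (by decide)]; exact h.blk, iu2 := by rw [Function.update_of_ne (by decide)]; exact h.iu2, pos := by rw [Function.update_of_ne (by decide)]; exact h.pos, res := by rw [Function.update_of_ne (by decide)]; exact h.res, val := by rw [Function.update_of_ne (by decide)]; exact h.val }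

/-- `ScanClean` survives an update of `s0`. [folklore] -/
theorem ScanClean.upd_s0 {T : AStore Γ' KR} (h : ScanClean T) (u : List Γ') : ScanClean (Function.update T KR.s0 u) :=
  { clw := by rw [Function.update_of_ne (by decide)]; exact h.clw, md := by rw [Function.update_of_ne (by decide)]; exact h.md, pol := by rw [Function.update_of_ne (by decide)]; exact h.pol, tag := by rw [Function.update_of_ne (by decide)]; exact h.tag, pr := by rw [Function.update_of_ne (by decide)]; exact h.pr, blk := by rw [Function.update_of_ne (by decide)]; exact h.blk, iu2 := by rw [Function.update_of_ne (by decide)]; exact h.iu2, pos := by rw [Function.update_of_ne (by decide)]; exact h.pos, res := by rw [Function.update_of_ne (by decide)]; exact h.res, val := by rw [Function.update_of_ne (by decide)]; exact h.val }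

/-- `ScanClean` survives an update of `iu`. [folklore] -/
theorem ScanClean.upd_iu {T : AStore Γ' KR} (h : ScanClean T) (u : List Γ') : ScanClean (Function.update T KR.iu u) :=
  { clw := by rw [Function.update_of_ne (by decide)]; exact h.clw, md := by rw [Function.update_of_ne (by decide)]; exact h.md, pol := by rw [Function.update_of_ne (by decide)]; exact h.pol, tag := by rw [Function.update_of_ne (by decide)]; exact h.tag, pr := by rw [Function.update_of_ne (by decide)]; exact h.pr, blk := by rw [Function.update_of_ne (by decide)]; exact h.blk, iu2 := by rw [Function.update_of_ne (by decide)]; exact h.iu2, pos := by rw [Function.update_of_ne (by decide)]; exact h.pos, res := by rw [Function.update_of_ne (by decide)]; exact h.res, val := by rw [Function.update_of_ne (by decide)]; exact h.val }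

/-- `ThetaClean` survives an update of `ac2`. [folklore] -/
theorem ThetaClean.upd_ac2 {T : AStore Γ' KR} {i : ℕ} (h : ThetaClean T i) (u : List Γ') : ThetaClean (Function.update T KR.ac2 u) i :=
  { iu := by rw [Function.update_of_ne (by decide)]; exact h.iu, u1 := by rw [Function.update_of_ne (by decide)]; exact h.u1, fl2 := by rw [Function.update_of_ne (by decide)]; exact h.fl2, fl3 := by rw [Function.update_of_ne (by decide)]; exact h.fl3 }

/-- `ThetaClean` survives an update of `c2`. [folklore] -/
theorem ThetaClean.upd_c2 {T : AStore Γ' KR} {i : ℕ} (h : ThetaClean T i) (u : List Γ') : ThetaClean (Function.update T KR.c2 u) i :=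
  { iu := by rw [Function.update_of_ne (by decide)]; exact h.iu, u1 := by rw [Function.update_of_ne (by decide)]; exact h.u1, fl2 := by rw [Function.update_of_ne (by decide)]; exact h.fl2, fl3 := by rw [Function.update_of_ne (by decide)]; exact h.fl3 }

/-- `ThetaClean` survives an update of `cl`. [folklore] -/
theorem ThetaClean.upd_cl {T : AStore Γ' KR} {i : ℕ} (h : ThetaClean T i) (u : List Γ') : ThetaClean (Function.update T KR.cl u) i :=
  { iu := by rw [Function.update_of_ne (by decide)]; exact h.iu, u1 := by rw [Function.update_of_ne (by decide)]; exact h.u1, fl2 := by rw [Function.update_of_ne (by decide)]; exact h.fl2, fl3 := by rw [Function.update_of_ne (by decide)]; exact h.fl3 }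

/-- `ThetaClean` survives an update of `s0`. [folklore] -/
theorem ThetaClean.upd_s0 {T : AStore Γ' KR} {i : ℕ} (h : ThetaClean T i) (u : List Γ') : ThetaClean (Function.update T KR.s0 u) i :=
  { iu := by rw [Function.update_of_ne (by decide)]; exact h.iu, u1 := by rw [Function.update_of_ne (by decide)]; exact h.u1, fl2 := by rw [Function.update_of_ne (by decide)]; exact h.fl2, fl3 := by rw [Function.update_of_ne (by decide)]; exact h.fl3 }

/-- `ThetaClean` survives an update of `blk`. [folklore] -/
theorem ThetaClean.upd_blk {T : AStore Γ' KR} {i : ℕ} (h : ThetaClean T i) (u : List Γ') : ThetaClean (Function.update T KR.blk u) i :=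
  { iu := by rw [Function.update_of_ne (by decide)]; exact h.iu, u1 := by rw [Function.update_of_ne (by decide)]; exact h.u1, fl2 := by rw [Function.update_of_ne (by decide)]; exact h.fl2, fl3 := by rw [Function.update_of_ne (by decide)]; exact h.fl3 }

/-! ### Driving the emission loop over the clauses of `F` -/

/-- One clause: move the staged annotated clause to `cl`, build its dependency list in `vt`, arm
and run the emission loop around the clause evaluator, clean up. [folklore] -/
def clauseStep : RProg :=
  pour (kr KR.c2) (kr KR.cl) ;; vBuild ;; push (tb TB.go) Γ'.blank ;; cnfLoop evalClause ;; clear (kr KR.cl) ;;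
  clear (tb TB.vt)

/-- Body of the clause driver: stage the symbols of the current annotated clause (reversed) in
`c2`; at its closing blank, process it. [folklore] -/
def cdBody (s : Γ') : RProg := if s = Γ'.blank then clauseStep else push (kr KR.c2) s

/-- **The clause driver**: over a copy of the annotated clause list `ac`, emit the truth-table
CNFs of all substituted clauses. [folklore] -/
def clauseDrive : RProg := copyToG (kr KR.ac) (kr KR.ac2) (kr KR.t1) (kr KR.t2) ;; loop (kr KR.ac2) cdBody

/-- The cost of the emission loop for the variable list `V` around an evaluator of cost `cE`.
[folklore] -/
def cnfCost (V : List ℕ) (cE : ℕ) : ℕ := (cE + 22 * idxLen V + 12 + 2) * 2 ^ V.length + 1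

/-- The annotated word of a clause (without its closing blank). [folklore] -/
def aclW (P : Params) (F : List (List (ℕ × Bool))) (c : List (ℕ × Bool)) : List Γ' := (c.map (annLit P F)).flatMap wALit

/-- The cost of processing one clause. [folklore] -/
def clauseCost (P : Params) (F : List (List (ℕ × Bool))) (c : List (ℕ × Bool)) : ℕ :=
  let V := depClause P F c
  let m := (aclW P F c).length
  let w := (cbody (V.map fun v => (v, false))).length
  3 * m + ((3 * m + 1) + ((vbK (btab P F) (ytab P F) + 10) * m + 3 * w + 5) + 1 +
    cnfCost V ((evKV V (btab P F) (ytab P F) + 10) * m + 7) + (2 * m + 1) + (2 * w + 1)) + 2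

/-- `wAClause` is the annotated word closed by a blank. [folklore] -/
theorem wAClause_eq (P : Params) (F : List (List (ℕ × Bool))) (c : List (ℕ × Bool)) :
    wAClause P F c = aclW P F c ++ [Γ'.blank] := rfl

/-- The blank does not occur in an annotated literal. [folklore] -/
theorem blank_not_mem_wALit (al : ALit) : Γ'.blank ∉ wALit al := by
  cases al <;> simp [wALit, wIdx]

/-- The blank does not occur in the annotated word of a clause. [folklore] -/
theorem blank_not_mem_aclW (P : Params) (F : List (List (ℕ × Bool))) (c : List (ℕ × Bool)) : Γ'.blank ∉ aclW P F c := by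
  simp only [aclW, List.mem_flatMap, not_exists, not_and]
  exact fun al _ => blank_not_mem_wALit al

/-- What the clause driver needs of the work registers, besides the evaluator's needs. [folklore] -/
structure DriveBase (T : AStore Γ' KR) (P : Params) (F : List (List (ℕ × Bool))) : Prop where
  /-- the evaluator's needs -/
  kb : KBase T (btab P F) (ytab P F)
  /-- the scan's registers -/
  sc : ScanClean T
  /-- the current clause -/
  cl : T KR.cl = []
  /-- the staging register -/
  c2 : T KR.c2 = []

section Drive

variable (P : Params) (F : List (List (ℕ × Bool)))

/-- The store of the clause driver: the emission bank `L`, the work registers `T` with the loop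
register `ac2` and the staging register `c2` set. [folklore] -/
def cdSt (L : AStore Γ' TB) (T : AStore Γ' KR) (w stg : List Γ') : RStore :=
  Sum.elim L (Function.update (Function.update T KR.ac2 w) KR.c2 stg)

/-- Reading `ac2`. [folklore] -/
@[simp] theorem cdSt_ac2 (L : AStore Γ' TB) (T : AStore Γ' KR) (w stg : List Γ') : cdSt L T w stg (kr KR.ac2) = w := by
  simp [cdSt]
/-- Reading `c2`. [folklore] -/
@[simp] theorem cdSt_c2 (L : AStore Γ' TB) (T : AStore Γ' KR) (w stg : List Γ') : cdSt L T w stg (kr KR.c2) = stg := by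
  simp [cdSt]
/-- Updating `ac2`. [folklore] -/
@[simp] theorem update_cdSt_ac2 (L : AStore Γ' TB) (T : AStore Γ' KR) (w stg u : List Γ') :
    Function.update (cdSt L T w stg) (kr KR.ac2) u = cdSt L T u stg := by
  unfold cdSt kr
  rw [Sum.update_elim_inr, Function.update_comm (by decide), Function.update_idem, Function.update_comm (by decide)]
/-- Updating `c2`. [folklore] -/
@[simp] theorem update_cdSt_c2 (L : AStore Γ' TB) (T : AStore Γ' KR) (w stg u : List Γ') :
    Function.update (cdSt L T w stg) (kr KR.c2) u = cdSt L T w u := by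
  unfold cdSt kr
  rw [Sum.update_elim_inr, Function.update_idem]

/-- **Staging the symbols of a clause.** [folklore] -/
theorem segRuns_cd_stage (L : AStore Γ' TB) (T : AStore Γ' KR) :
    ∀ (u : List Γ'), Γ'.blank ∉ u → ∀ (rest stg : List Γ'),
      SegRuns (kr KR.ac2) cdBody u (cdSt L T (u ++ rest) stg) (cdSt L T rest (u.reverse ++ stg)) (3 * u.length)
  | [], _, rest, stg => by simpa using SegRuns.nil (kr KR.ac2) cdBody _
  | s :: u, hu, rest, stg => by
    have hs : s ≠ Γ'.blank := fun h => hu (by simp [h])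
    have hu' : Γ'.blank ∉ u := fun h => hu (by simp [h])
    have hbody : Runs (cdBody s) (Function.update (cdSt L T (s :: u ++ rest) stg) (kr KR.ac2) (u ++ rest))
        (cdSt L T (u ++ rest) (s :: stg)) 1 := by
      rw [update_cdSt_ac2]; unfold cdBody; rw [if_neg hs]
      exact Runs.push' (by simp)
    have ih := segRuns_cd_stage L T u hu' rest (s :: stg)
    have hk : cdSt L T (s :: u ++ rest) stg (kr KR.ac2) = s :: (u ++ rest) := by simp
    refine (SegRuns.cons hk hbody ih).cast rfl rfl (by simp) ?_
    simp only [List.length_cons]; omega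

end Drive

section Drive2

variable (P : Params) (F : List (List (ℕ × Bool)))

/-- Updating a work register other than `ac2`, `c2` commutes with `cdSt`. [folklore] -/
theorem update_cdSt_kr (L : AStore Γ' TB) (T : AStore Γ' KR) (w stg u : List Γ') {x : KR} (h1 : x ≠ KR.ac2) (h2 : x ≠ KR.c2) :
    Function.update (cdSt L T w stg) (kr x) u = cdSt L (Function.update T x u) w stg := by
  unfold cdSt kr
  rw [Sum.update_elim_inr, Function.update_comm (Ne.symm h2), Function.update_comm (Ne.symm h1)]

/-- Updating an emission register commutes with `cdSt`. [folklore] -/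
theorem update_cdSt_tb (L : AStore Γ' TB) (T : AStore Γ' KR) (w stg u : List Γ') (y : TB) :
    Function.update (cdSt L T w stg) (tb y) u = cdSt (Function.update L y u) T w stg := by
  unfold cdSt tb
  rw [Sum.update_elim_inl]

/-- Reading a work register other than `ac2`, `c2`. [folklore] -/
theorem cdSt_kr (L : AStore Γ' TB) (T : AStore Γ' KR) (w stg : List Γ') {x : KR} (h1 : x ≠ KR.ac2) (h2 : x ≠ KR.c2) :
    cdSt L T w stg (kr x) = T x := by
  simp [cdSt, Function.update_of_ne h1, Function.update_of_ne h2]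

/-- Reading an emission register. [folklore] -/
@[simp] theorem cdSt_tb (L : AStore Γ' TB) (T : AStore Γ' KR) (w stg : List Γ') (y : TB) : cdSt L T w stg (tb y) = L y := by
  simp [cdSt]

/-- `cdSt` unfolded. [folklore] -/
theorem cdSt_eq (L : AStore Γ' TB) (T : AStore Γ' KR) (w stg : List Γ') :
    cdSt L T w stg = Sum.elim L (Function.update (Function.update T KR.ac2 w) KR.c2 stg) := rfl

/-- **Processing one clause.** [folklore] -/
theorem runs_clauseStep (T : AStore Γ' KR) (hD : DriveBase T P F) (c : List (ℕ × Bool)) (rest acc : List Γ') :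
    Runs clauseStep (cdSt (tbSt [] acc [] [] [] [] []) T rest (aclW P F c).reverse)
      (cdSt (tbSt [] ((wFam (cnf (gClause P F c) (depClause P F c))).reverse ++ acc) [] [] [] [] []) T rest [])
      (clauseCost P F c - 3 * (aclW P F c).length - 2) := by
  set V := depClause P F c with hV
  set m := (aclW P F c).length with hm
  set w := (cbody (V.map fun v => (v, false))).length with hw
  have hwf : ∀ al ∈ c.map (annLit P F), al.WF (btab P F) (ytab P F) := fun al hal => by
    obtain ⟨l, -, rfl⟩ := List.mem_map.1 hal; exact annLit_wf P F l
  have hvd : vdepW (btab P F) (ytab P F) (c.map (annLit P F)) = cbody (V.zip (List.replicate V.length false)) := by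
    rw [vdepW_eq, zip_replicate_false]
  unfold clauseStep
  -- 1. the staged clause to `cl`
  set S0 := cdSt (tbSt [] acc [] [] [] [] []) T rest (aclW P F c).reverse with hS0
  have h1 := runs_pour (a := kr KR.c2) (b := kr KR.cl) (by simp) S0
  have e1a : S0 (kr KR.c2) = (aclW P F c).reverse := by simp [hS0]
  have e1b : S0 (kr KR.cl) = [] := by rw [hS0, cdSt_kr _ _ _ _ (by decide) (by decide)]; exact hD.cl
  rw [e1a, e1b, List.length_reverse, List.reverse_reverse, List.append_nil] at h1
  set T1 := Function.update T KR.cl (aclW P F c) with hT1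
  have eS1 : Function.update (Function.update S0 (kr KR.c2) []) (kr KR.cl) (aclW P F c) = cdSt (tbSt [] acc [] [] [] [] []) T1 rest [] := by
    rw [hS0, update_cdSt_c2, update_cdSt_kr _ _ _ _ _ (by decide) (by decide)]
  rw [eS1] at h1
  -- 2. the dependency list
  set S1 := cdSt (tbSt [] acc [] [] [] [] []) T1 rest [] with hS1
  have hsc1 : ScanClean T1 := hD.sc.upd_cl _
  have hkb1 : KBase T1 (btab P F) (ytab P F) := hD.kb.upd_cl _
  have hVb : VbBase S1 (btab P F) (ytab P F) :=
    { bt := by rw [hS1, cdSt_kr _ _ _ _ (by decide) (by decide)]; exact hkb1.bt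
      yt := by rw [hS1, cdSt_kr _ _ _ _ (by decide) (by decide)]; exact hkb1.yt
      t1 := by rw [hS1, cdSt_kr _ _ _ _ (by decide) (by decide)]; exact hkb1.t1
      t2 := by rw [hS1, cdSt_kr _ _ _ _ (by decide) (by decide)]; exact hkb1.t2
      btw := by rw [hS1, cdSt_kr _ _ _ _ (by decide) (by decide)]; exact hkb1.btw
      md2 := by rw [hS1, cdSt_kr _ _ _ _ (by decide) (by decide)]; exact hkb1.md2
      ytw := by rw [hS1, cdSt_kr _ _ _ _ (by decide) (by decide)]; exact hkb1.ytw }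
  have h2 := runs_vBuild S1 (btab P F) (ytab P F) hVb (c.map (annLit P F)) hwf
    (by rw [hS1, cdSt_kr _ _ _ _ (by decide) (by decide), hT1]; simp [aclW])
    (by rw [hS1, cdSt_kr _ _ _ _ (by decide) (by decide)]; exact hsc1.clw)
    (by rw [hS1, cdSt_kr _ _ _ _ (by decide) (by decide)]; exact hsc1.md)
    (by rw [hS1, cdSt_kr _ _ _ _ (by decide) (by decide)]; exact hsc1.blk)
    (by rw [hS1, cdSt_kr _ _ _ _ (by decide) (by decide)]; exact hsc1.iu2) (by simp [hS1]) (by simp [hS1])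
  rw [hvd] at h2
  have eS2 : Function.update S1 (tb TB.vt) (cbody (V.zip (List.replicate V.length false))) =
      cdSt (tbSt (cbody (V.zip (List.replicate V.length false))) acc [] [] [] [] []) T1 rest [] := by
    rw [hS1, update_cdSt_tb, update_tbSt_vt]
  rw [eS2] at h2
  -- 3. arm
  have h3 : Runs (push (tb TB.go) Γ'.blank) (cdSt (tbSt (cbody (V.zip (List.replicate V.length false))) acc [] [] [] [] []) T1 rest [])
      (cdSt (tbSt (cbody (V.zip (List.replicate V.length false))) acc [] [Γ'.blank] [] [] []) T1 rest []) 1 :=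
    Runs.push' (by rw [cdSt_tb, update_cdSt_tb]; simp)
  -- 4. the emission loop
  have hK' : KBase (Function.update (Function.update T1 KR.ac2 rest) KR.c2 []) (btab P F) (ytab P F) := (hkb1.upd_ac2 _).upd_c2 _
  have hS' : ScanClean (Function.update (Function.update T1 KR.ac2 rest) KR.c2 []) := (hsc1.upd_ac2 _).upd_c2 _
  have h4 := runs_cnfLoop_gClause P F c (Function.update (Function.update T1 KR.ac2 rest) KR.c2 []) hK' hS'
    (by rw [Function.update_of_ne (by decide), Function.update_of_ne (by decide), hT1]; simp [aclW]) V acc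
  rw [← cdSt_eq, ← cdSt_eq] at h4
  -- 5./6. cleanup
  set acc' := (wFam (cnf (gClause P F c) V)).reverse ++ acc with hacc'
  have h5 := runs_clear (kr KR.cl) (cdSt (tbSt (cbody (V.zip (List.replicate V.length false))) acc' [] [] [] [] []) T1 rest [])
  have e5 : cdSt (tbSt (cbody (V.zip (List.replicate V.length false))) acc' [] [] [] [] []) T1 rest [] (kr KR.cl) = aclW P F c := by
    rw [cdSt_kr _ _ _ _ (by decide) (by decide), hT1]; simp
  have eT : Function.update T1 KR.cl [] = T := by rw [hT1, Function.update_idem]; exact Function.update_eq_self_iff.2 hD.cl.symm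
  rw [e5, update_cdSt_kr _ _ _ _ _ (by decide) (by decide), eT] at h5
  have h6 := runs_clear (tb TB.vt) (cdSt (tbSt (cbody (V.zip (List.replicate V.length false))) acc' [] [] [] [] []) T rest [])
  rw [cdSt_tb, update_cdSt_tb, update_tbSt_vt] at h6
  simp only [tbSt] at h6
  refine (h1.seq (h2.seq (h3.seq (h4.seq (h5.seq h6))))).of_eq rfl ?_
  have hlen : (cbody (V.zip (List.replicate V.length false))).length = w := by rw [hw, zip_replicate_false]
  rw [hlen]
  have em : ((c.map (annLit P F)).flatMap wALit).length = m := rfl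
  rw [em]
  unfold clauseCost cnfCost
  simp only [← hV, ← hm, ← hw]
  omega

/-- **One clause of the list: staging, then processing.** [folklore] -/
theorem segRuns_cd_clause (T : AStore Γ' KR) (hD : DriveBase T P F) (c : List (ℕ × Bool)) (rest acc : List Γ') :
    SegRuns (kr KR.ac2) cdBody (wAClause P F c) (cdSt (tbSt [] acc [] [] [] [] []) T (wAClause P F c ++ rest) [])
      (cdSt (tbSt [] ((wFam (cnf (gClause P F c) (depClause P F c))).reverse ++ acc) [] [] [] [] []) T rest [])
      (clauseCost P F c) := by
  rw [wAClause_eq]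
  have h1 := segRuns_cd_stage (tbSt [] acc [] [] [] [] []) T (aclW P F c) (blank_not_mem_aclW P F c) ([Γ'.blank] ++ rest) []
  rw [List.append_nil] at h1
  have h2 : Runs (cdBody Γ'.blank) (Function.update (cdSt (tbSt [] acc [] [] [] [] []) T ([Γ'.blank] ++ rest) (aclW P F c).reverse)
      (kr KR.ac2) rest)
      (cdSt (tbSt [] ((wFam (cnf (gClause P F c) (depClause P F c))).reverse ++ acc) [] [] [] [] []) T rest [])
      (clauseCost P F c - 3 * (aclW P F c).length - 2) := by
    rw [update_cdSt_ac2]; unfold cdBody; rw [if_pos rfl]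
    exact runs_clauseStep P F T hD c rest acc
  have hk : cdSt (tbSt [] acc [] [] [] [] []) T ([Γ'.blank] ++ rest) (aclW P F c).reverse (kr KR.ac2) = Γ'.blank :: rest := by simp
  have := h1.append (SegRuns.single hk h2)
  refine this.cast rfl (by simp) rfl ?_
  have : 3 * (aclW P F c).length + 2 ≤ clauseCost P F c := by simp only [clauseCost]; omega
  omega

/-- **The clauses of the list.** [folklore] -/
theorem segRuns_cd_clauses (T : AStore Γ' KR) (hD : DriveBase T P F) : ∀ (G : List (List (ℕ × Bool))) (rest acc : List Γ'),
    SegRuns (kr KR.ac2) cdBody (G.flatMap (wAClause P F)) (cdSt (tbSt [] acc [] [] [] [] []) T (G.flatMap (wAClause P F) ++ rest) [])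
      (cdSt (tbSt [] ((wFam (G.flatMap fun c => cnf (gClause P F c) (depClause P F c))).reverse ++ acc) [] [] [] [] []) T rest [])
      ((G.map (clauseCost P F)).sum)
  | [], rest, acc => by simpa [wFam] using SegRuns.nil (kr KR.ac2) cdBody _
  | c :: G, rest, acc => by
    have h1 := segRuns_cd_clause P F T hD c (G.flatMap (wAClause P F) ++ rest) acc
    have h2 := segRuns_cd_clauses T hD G rest ((wFam (cnf (gClause P F c) (depClause P F c))).reverse ++ acc)
    have := h1.append h2
    refine this.cast (by simp) (by simp) ?_ (by simp)
    simp [wFam_append]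

/-- **Specification of the clause driver.** With the annotated clause list of `F` in `ac`, the
tables of `P`, `F` in `bt`, `yt`, and the other work registers clean, the driver pushes the word of
the first half of `outClauses P F` (the truth-table CNFs of the substituted clauses) reversed onto
the accumulator; the work registers are restored. [folklore] -/
theorem runs_clauseDrive (T : AStore Γ' KR) (hD : DriveBase T P F) (hac : T KR.ac = wAC P F) (hac2 : T KR.ac2 = []) (acc : List Γ') :
    Runs clauseDrive (Sum.elim (tbSt [] acc [] [] [] [] []) T)
      (Sum.elim (tbSt [] ((wFam (F.flatMap fun c => cnf (gClause P F c) (depClause P F c))).reverse ++ acc) [] [] [] [] []) T)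
      (10 * (wAC P F).length + 3 + (F.map (clauseCost P F)).sum + 1) := by
  have e1 : Function.update (Function.update T KR.ac2 []) KR.c2 [] = Function.update T KR.ac2 [] :=
    Function.update_eq_self_iff.2 (by rw [Function.update_of_ne (by decide)]; exact hD.c2.symm)
  have e2 : Function.update T KR.ac2 [] = T := Function.update_eq_self_iff.2 hac2.symm
  have eT : cdSt (tbSt [] acc [] [] [] [] []) T [] [] = Sum.elim (tbSt [] acc [] [] [] [] []) T := by
    rw [cdSt_eq, e1, e2]
  unfold clauseDrive
  have h0 := runs_copyToG (a := kr KR.ac) (b := kr KR.ac2) (t₁ := kr KR.t1) (t₂ := kr KR.t2)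
    (by simp) (by simp) (by simp) (by simp) (by simp) (by simp) (cdSt (tbSt [] acc [] [] [] [] []) T [] [])
    (by rw [cdSt_kr _ _ _ _ (by decide) (by decide)]; exact hD.kb.t1) (by rw [cdSt_kr _ _ _ _ (by decide) (by decide)]; exact hD.kb.t2)
    (by simp)
  rw [cdSt_kr _ _ _ _ (by decide) (by decide), hac, update_cdSt_ac2] at h0
  have h1 := (segRuns_cd_clauses P F T hD F [] acc).runs_loop_nil (by simp)
  rw [List.append_nil] at h1
  rw [eT] at h0
  refine (h0.seq h1).of_eq ?_ (by simp [wAC]; omega)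
  rw [cdSt_eq, e1, e2]

end Drive2

/-! ### Driving the emission loop over the blocks -/

/-- One block (index `i` as ticks in `iu`): build its dependency list `depTheta i` in `vt`, arm and
run the emission loop around the `Θ`-evaluator, clean up, increment `iu`. [folklore] -/
def thetaStep : RProg :=
  copyToG (kr KR.iu) (kr KR.blk) (kr KR.t1) (kr KR.t2) ;; vEmitBlock ;; pour (tb TB.tmp) (tb TB.vt) ;;
  push (tb TB.go) Γ'.blank ;; cnfLoop thetaEval ;; clear (tb TB.vt) ;; push (kr KR.iu) Γ'.blank

/-- Body of the block driver: act at the closing blank of each block of the copy of the block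
table. [folklore] -/
def tdBody (s : Γ') : RProg := if s = Γ'.blank then thetaStep else skip

/-- **The block driver**: over a copy (in the spare register `s0`) of the block table, emit the
truth-table CNFs of the slice constraints of all nonempty blocks. [folklore] -/
def thetaDrive : RProg := copyToG (kr KR.bt) (kr KR.s0) (kr KR.t1) (kr KR.t2) ;; loop (kr KR.s0) tdBody ;; clear (kr KR.iu)

/-- The cost of processing block `i`. [folklore] -/
def thetaCost (P : Params) (F : List (List (ℕ × Bool))) (i : ℕ) : ℕ :=
  let V := depTheta P F i
  let w := (cbody (V.map fun v => (v, false))).length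
  (10 * i + 3) + (20 * (wBT (btab P F)).length + 11) + (3 * w + 1) + 1 +
    cnfCost V ((60 * (idxLen V + 1) + 19) * (wBT (btab P F)).length + 42 * (wYT (ytab P F)).length + 51) + (2 * w + 1) + 1

/-- What the block driver needs of the work registers. [folklore] -/
structure TDriveBase (T : AStore Γ' KR) (P : Params) (F : List (List (ℕ × Bool))) : Prop where
  /-- the evaluator's needs -/
  kb : KBase T (btab P F) (ytab P F)
  /-- the scan's registers -/
  sc : ScanClean T
  /-- scratch -/
  u1 : T KR.u1 = []
  /-- scratch -/
  fl2 : T KR.fl2 = []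
  /-- scratch -/
  fl3 : T KR.fl3 = []

section TDrive

variable (P : Params) (F : List (List (ℕ × Bool)))

/-- The store of the block driver: the emission bank `L`, the work registers `T` with the loop
register `s0` and the block index in `iu`. [folklore] -/
def tdSt (L : AStore Γ' TB) (T : AStore Γ' KR) (w : List Γ') (i : ℕ) : RStore :=
  Sum.elim L (Function.update (Function.update T KR.s0 w) KR.iu (ticks Γ'.blank i))

/-- `tdSt` unfolded. [folklore] -/
theorem tdSt_eq (L : AStore Γ' TB) (T : AStore Γ' KR) (w : List Γ') (i : ℕ) :
    tdSt L T w i = Sum.elim L (Function.update (Function.update T KR.s0 w) KR.iu (ticks Γ'.blank i)) := rfl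
/-- Reading `s0`. [folklore] -/
@[simp] theorem tdSt_s0 (L : AStore Γ' TB) (T : AStore Γ' KR) (w : List Γ') (i : ℕ) : tdSt L T w i (kr KR.s0) = w := by simp [tdSt]
/-- Reading `iu`. [folklore] -/
@[simp] theorem tdSt_iu (L : AStore Γ' TB) (T : AStore Γ' KR) (w : List Γ') (i : ℕ) : tdSt L T w i (kr KR.iu) = ticks Γ'.blank i := by
  simp [tdSt]
/-- Reading an emission register. [folklore] -/
@[simp] theorem tdSt_tb (L : AStore Γ' TB) (T : AStore Γ' KR) (w : List Γ') (i : ℕ) (y : TB) : tdSt L T w i (tb y) = L y := by simp [tdSt]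
/-- Reading a work register other than `s0`, `iu`. [folklore] -/
theorem tdSt_kr (L : AStore Γ' TB) (T : AStore Γ' KR) (w : List Γ') (i : ℕ) {x : KR} (h1 : x ≠ KR.s0) (h2 : x ≠ KR.iu) :
    tdSt L T w i (kr x) = T x := by simp [tdSt, Function.update_of_ne h1, Function.update_of_ne h2]
/-- Updating `s0`. [folklore] -/
@[simp] theorem update_tdSt_s0 (L : AStore Γ' TB) (T : AStore Γ' KR) (w u : List Γ') (i : ℕ) :
    Function.update (tdSt L T w i) (kr KR.s0) u = tdSt L T u i := by
  unfold tdSt kr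
  rw [Sum.update_elim_inr, Function.update_comm (by decide), Function.update_idem, Function.update_comm (by decide)]
/-- Updating `iu`. [folklore] -/
theorem update_tdSt_iu (L : AStore Γ' TB) (T : AStore Γ' KR) (w : List Γ') (i j : ℕ) :
    Function.update (tdSt L T w i) (kr KR.iu) (ticks Γ'.blank j) = tdSt L T w j := by
  unfold tdSt kr
  rw [Sum.update_elim_inr, Function.update_idem]
/-- Updating another work register. [folklore] -/
theorem update_tdSt_kr (L : AStore Γ' TB) (T : AStore Γ' KR) (w u : List Γ') (i : ℕ) {x : KR} (h1 : x ≠ KR.s0) (h2 : x ≠ KR.iu) :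
    Function.update (tdSt L T w i) (kr x) u = tdSt L (Function.update T x u) w i := by
  unfold tdSt kr
  rw [Sum.update_elim_inr, Function.update_comm (Ne.symm h2), Function.update_comm (Ne.symm h1)]
/-- Updating an emission register. [folklore] -/
theorem update_tdSt_tb (L : AStore Γ' TB) (T : AStore Γ' KR) (w u : List Γ') (i : ℕ) (y : TB) :
    Function.update (tdSt L T w i) (tb y) u = tdSt (Function.update L y u) T w i := by
  unfold tdSt tb
  rw [Sum.update_elim_inl]

/-- **Processing block `i`.** [folklore] -/
theorem runs_thetaStep (T : AStore Γ' KR) (hD : TDriveBase T P F) (i : ℕ) (hi : i < numNB P F) (rest acc : List Γ') :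
    Runs thetaStep (tdSt (tbSt [] acc [] [] [] [] []) T rest i)
      (tdSt (tbSt [] ((wFam (cnf (theta P F i) (depTheta P F i))).reverse ++ acc) [] [] [] [] []) T rest (i + 1))
      (thetaCost P F i) := by
  set V := depTheta P F i with hV
  set w := (cbody (V.map fun v => (v, false))).length with hw
  have hib : i < (btab P F).length := by simp [btab, hi]
  have hdep : depW ((btab P F)[i]) = cbody (V.zip (List.replicate V.length false)) := by
    rw [zip_replicate_false, depW_eq, hV, depTheta_eq]
    simp [btab, List.getElem_map]
  unfold thetaStep
  set S0 := tdSt (tbSt [] acc [] [] [] [] []) T rest i with hS0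
  -- 1. copy `iu` to `blk`
  have h1 := runs_copyToG (a := kr KR.iu) (b := kr KR.blk) (t₁ := kr KR.t1) (t₂ := kr KR.t2)
    (by simp) (by simp) (by simp) (by simp) (by simp) (by simp) S0
    (by rw [hS0, tdSt_kr _ _ _ _ (by decide) (by decide)]; exact hD.kb.t1)
    (by rw [hS0, tdSt_kr _ _ _ _ (by decide) (by decide)]; exact hD.kb.t2)
    (by rw [hS0, tdSt_kr _ _ _ _ (by decide) (by decide)]; exact hD.sc.blk)
  rw [hS0, tdSt_iu, update_tdSt_kr _ _ _ _ _ (by decide) (by decide)] at h1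
  set T1 := Function.update T KR.blk (ticks Γ'.blank i) with hT1
  set S1 := tdSt (tbSt [] acc [] [] [] [] []) T1 rest i with hS1
  -- 2. the dependency literals of the block
  have h2 := runs_vEmitBlock' S1 (btab P F) i hib
    (by rw [hS1, tdSt_kr _ _ _ _ (by decide) (by decide), hT1, Function.update_of_ne (by decide)]; exact hD.kb.bt)
    (by rw [hS1, tdSt_kr _ _ _ _ (by decide) (by decide), hT1]; simp)
    (by rw [hS1, tdSt_kr _ _ _ _ (by decide) (by decide), hT1, Function.update_of_ne (by decide)]; exact hD.kb.t1)
    (by rw [hS1, tdSt_kr _ _ _ _ (by decide) (by decide), hT1, Function.update_of_ne (by decide)]; exact hD.kb.t2)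
    (by rw [hS1, tdSt_kr _ _ _ _ (by decide) (by decide), hT1, Function.update_of_ne (by decide)]; exact hD.kb.btw)
    (by rw [hS1, tdSt_kr _ _ _ _ (by decide) (by decide), hT1, Function.update_of_ne (by decide)]; exact hD.kb.md2)
  have eT1 : Function.update T1 KR.blk [] = T := by
    rw [hT1, Function.update_idem]; exact Function.update_eq_self_iff.2 hD.sc.blk.symm
  have eS2 : Function.update (Function.update S1 (kr KR.blk) []) (tb TB.tmp) ((depW (btab P F)[i]).reverse ++ S1 (tb TB.tmp)) =
      tdSt (tbSt [] acc [] [] [] [] (cbody (V.zip (List.replicate V.length false))).reverse) T rest i := by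
    rw [hS1, update_tdSt_kr _ _ _ _ _ (by decide) (by decide), eT1, tdSt_tb, update_tdSt_tb, hdep]; simp
  rw [eS2] at h2
  -- 3. into the tuple register
  have h3 := runs_pour (a := tb TB.tmp) (b := tb TB.vt) (by simp)
    (tdSt (tbSt [] acc [] [] [] [] (cbody (V.zip (List.replicate V.length false))).reverse) T rest i)
  rw [tdSt_tb, tdSt_tb, update_tdSt_tb, update_tdSt_tb] at h3
  simp only [tbSt, List.length_reverse, List.reverse_reverse, List.append_nil, update_tbSt_tmp, update_tbSt_vt] at h3
  -- 4. arm
  have h4 : Runs (push (tb TB.go) Γ'.blank) (tdSt (tbSt (cbody (V.zip (List.replicate V.length false))) acc [] [] [] [] []) T rest i)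
      (tdSt (tbSt (cbody (V.zip (List.replicate V.length false))) acc [] [Γ'.blank] [] [] []) T rest i) 1 :=
    Runs.push' (by rw [tdSt_tb, update_tdSt_tb]; simp)
  -- 5. the emission loop
  have hK' : KBase (Function.update (Function.update T KR.s0 rest) KR.iu (ticks Γ'.blank i)) (btab P F) (ytab P F) :=
    (hD.kb.upd_s0 _).upd_iu _
  have hS' : ScanClean (Function.update (Function.update T KR.s0 rest) KR.iu (ticks Γ'.blank i)) := (hD.sc.upd_s0 _).upd_iu _
  have hT' : ThetaClean (Function.update (Function.update T KR.s0 rest) KR.iu (ticks Γ'.blank i)) i :=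
    { iu := by simp
      u1 := by rw [Function.update_of_ne (by decide), Function.update_of_ne (by decide)]; exact hD.u1
      fl2 := by rw [Function.update_of_ne (by decide), Function.update_of_ne (by decide)]; exact hD.fl2
      fl3 := by rw [Function.update_of_ne (by decide), Function.update_of_ne (by decide)]; exact hD.fl3 }
  have h5 := runs_cnfLoop_theta P F i hi (Function.update (Function.update T KR.s0 rest) KR.iu (ticks Γ'.blank i)) hK' hS' hT' V acc
  rw [← tdSt_eq, ← tdSt_eq] at h5
  -- 6. cleanup, increment
  set acc' := (wFam (cnf (theta P F i) V)).reverse ++ acc with hacc'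
  have h6 := runs_clear (tb TB.vt) (tdSt (tbSt (cbody (V.zip (List.replicate V.length false))) acc' [] [] [] [] []) T rest i)
  rw [tdSt_tb, update_tdSt_tb, update_tbSt_vt] at h6
  simp only [tbSt] at h6
  have h7 : Runs (push (kr KR.iu) Γ'.blank) (tdSt (tbSt [] acc' [] [] [] [] []) T rest i) (tdSt (tbSt [] acc' [] [] [] [] []) T rest (i + 1)) 1 :=
    Runs.push' (by rw [tdSt_iu, ← ticks_succ, update_tdSt_iu])
  refine (h1.seq (h2.seq (h3.seq (h4.seq (h5.seq (h6.seq h7)))))).of_eq rfl ?_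
  have hlen : (cbody (V.zip (List.replicate V.length false))).length = w := by rw [hw, zip_replicate_false]
  rw [hlen, length_ticks]
  unfold thetaCost cnfCost
  simp only [← hV, ← hw]
  omega

/-- **The blocks from index `i` on.** [folklore] -/
theorem segRuns_td_blocks (T : AStore Γ' KR) (hD : TDriveBase T P F) :
    ∀ (zsss : List (List (List Entry))) (i : ℕ), i + zsss.length ≤ numNB P F → ∀ (rest acc : List Γ'),
      SegRuns (kr KR.s0) tdBody (zsss.flatMap wBlock) (tdSt (tbSt [] acc [] [] [] [] []) T (zsss.flatMap wBlock ++ rest) i)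
        (tdSt (tbSt [] ((wFam (((List.range zsss.length).map (i + ·)).flatMap fun j => cnf (theta P F j) (depTheta P F j))).reverse
          ++ acc) [] [] [] [] []) T rest (i + zsss.length))
        ((((List.range zsss.length).map (i + ·)).map (thetaCost P F)).sum + 2 * (zsss.flatMap wBlock).length)
  | [], i, _, rest, acc => by simpa [wFam] using SegRuns.nil (kr KR.s0) tdBody _
  | zs :: zsss, i, hle, rest, acc => by
    have hi : i < numNB P F := by simp at hle; omega
    -- the symbols of the block are skipped
    have hskip : ∀ (u : List Γ'), Γ'.blank ∉ u → ∀ (rest' : List Γ') (L : AStore Γ' TB) (j : ℕ),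
        SegRuns (kr KR.s0) tdBody u (tdSt L T (u ++ rest') j) (tdSt L T rest' j) (2 * u.length) := by
      intro u
      induction u with
      | nil => intro _ rest' L j; simpa using SegRuns.nil (kr KR.s0) tdBody _
      | cons s u ih =>
        intro hu rest' L j
        have hs : s ≠ Γ'.blank := fun h => hu (by simp [h])
        have hbody : Runs (tdBody s) (Function.update (tdSt L T (s :: u ++ rest') j) (kr KR.s0) (u ++ rest')) (tdSt L T (u ++ rest') j) 0 := by
          rw [update_tdSt_s0]; unfold tdBody; rw [if_neg hs]; exact Runs.skip _
        have hk : tdSt L T (s :: u ++ rest') j (kr KR.s0) = s :: (u ++ rest') := by simp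
        refine (SegRuns.cons hk hbody (ih (fun h => hu (by simp [h])) rest' L j)).cast rfl rfl rfl ?_
        simp only [List.length_cons]; omega
    have h1 := hskip (zs.flatMap wVar) (blank_not_mem_flatMap_wVar zs) ([Γ'.blank] ++ (zsss.flatMap wBlock ++ rest))
      (tbSt [] acc [] [] [] [] []) i
    have h2 : Runs (tdBody Γ'.blank) (Function.update (tdSt (tbSt [] acc [] [] [] [] []) T ([Γ'.blank] ++ (zsss.flatMap wBlock ++ rest)) i)
        (kr KR.s0) (zsss.flatMap wBlock ++ rest))
        (tdSt (tbSt [] ((wFam (cnf (theta P F i) (depTheta P F i))).reverse ++ acc) [] [] [] [] []) T (zsss.flatMap wBlock ++ rest) (i + 1))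
        (thetaCost P F i) := by
      rw [update_tdSt_s0]; unfold tdBody; rw [if_pos rfl]
      exact runs_thetaStep P F T hD i hi _ acc
    have hk : tdSt (tbSt [] acc [] [] [] [] []) T ([Γ'.blank] ++ (zsss.flatMap wBlock ++ rest)) i (kr KR.s0) =
        Γ'.blank :: (zsss.flatMap wBlock ++ rest) := by simp
    have h3 := segRuns_td_blocks T hD zsss (i + 1) (by simp at hle ⊢; omega) rest ((wFam (cnf (theta P F i) (depTheta P F i))).reverse ++ acc)
    have := (h1.append (SegRuns.single hk h2)).append h3
    refine this.cast (by simp [wBlock]) (by simp [wBlock]) ?_ ?_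
    · have er : (List.range (zs :: zsss).length).map (i + ·) = i :: (List.range zsss.length).map (i + 1 + ·) := by
        rw [List.length_cons, List.range_succ_eq_map, List.map_cons, List.map_map]
        refine congrArg₂ List.cons (by simp) (List.map_congr_left fun j _ => ?_)
        simp only [Function.comp_apply]; omega
      rw [er, List.flatMap_cons, wFam_append, List.reverse_append, List.append_assoc, List.length_cons]
      rw [show i + 1 + zsss.length = i + (zsss.length + 1) by omega]
    · have er : (List.range (zs :: zsss).length).map (i + ·) = i :: (List.range zsss.length).map (i + 1 + ·) := by
        rw [List.length_cons, List.range_succ_eq_map, List.map_cons, List.map_map]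
        refine congrArg₂ List.cons (by simp) (List.map_congr_left fun j _ => ?_)
        simp only [Function.comp_apply]; omega
      rw [er]
      simp only [List.map_cons, List.sum_cons, wBlock, List.flatMap_cons, List.length_append, List.length_singleton]
      omega

/-- **Specification of the block driver.** With the tables of `P`, `F` in `bt`, `yt` and the other
work registers clean (`iu`, `s0` empty), the driver pushes the word of the truth-table CNFs of the
slice constraints of the nonempty blocks, reversed, onto the accumulator; the work registers are
restored. [folklore] -/
theorem runs_thetaDrive (T : AStore Γ' KR) (hD : TDriveBase T P F) (hiu : T KR.iu = []) (hs0 : T KR.s0 = []) (acc : List Γ') :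
    Runs thetaDrive (Sum.elim (tbSt [] acc [] [] [] [] []) T)
      (Sum.elim (tbSt [] ((wFam ((List.range (numNB P F)).flatMap fun j => cnf (theta P F j) (depTheta P F j))).reverse ++ acc)
        [] [] [] [] []) T)
      (10 * (wBT (btab P F)).length + 3 + (((List.range (numNB P F)).map (thetaCost P F)).sum + 2 * (wBT (btab P F)).length + 1) +
        (2 * numNB P F + 1)) := by
  have e1 : Function.update (Function.update T KR.s0 []) KR.iu (ticks Γ'.blank 0) = Function.update T KR.s0 [] :=
    Function.update_eq_self_iff.2 (by rw [Function.update_of_ne (by decide), ticks_zero]; exact hiu.symm)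
  have e2 : Function.update T KR.s0 [] = T := Function.update_eq_self_iff.2 hs0.symm
  have eT : tdSt (tbSt [] acc [] [] [] [] []) T [] 0 = Sum.elim (tbSt [] acc [] [] [] [] []) T := by rw [tdSt_eq, e1, e2]
  have hlen : (btab P F).length = numNB P F := by simp [btab]
  unfold thetaDrive
  have h0 := runs_copyToG (a := kr KR.bt) (b := kr KR.s0) (t₁ := kr KR.t1) (t₂ := kr KR.t2)
    (by simp) (by simp) (by simp) (by simp) (by simp) (by simp) (tdSt (tbSt [] acc [] [] [] [] []) T [] 0)
    (by rw [tdSt_kr _ _ _ _ (by decide) (by decide)]; exact hD.kb.t1) (by rw [tdSt_kr _ _ _ _ (by decide) (by decide)]; exact hD.kb.t2)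
    (by simp)
  rw [tdSt_kr _ _ _ _ (by decide) (by decide), hD.kb.bt, update_tdSt_s0] at h0
  have h1 := (segRuns_td_blocks P F T hD (btab P F) 0 (by omega) [] acc).runs_loop_nil (by simp)
  simp only [List.append_nil, Nat.zero_add, hlen, List.map_id'] at h1
  set L1 := tbSt [] ((wFam ((List.range (numNB P F)).flatMap fun j => cnf (theta P F j) (depTheta P F j))).reverse ++ acc)
    [] [] [] [] [] with hL1
  have h2 := runs_clear (kr KR.iu) (tdSt L1 T [] (numNB P F))
  have eu : Function.update (tdSt L1 T [] (numNB P F)) (kr KR.iu) [] = tdSt L1 T [] 0 := update_tdSt_iu L1 T [] (numNB P F) 0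
  rw [tdSt_iu, length_ticks, eu] at h2
  rw [eT] at h0
  refine (h0.seq (h1.seq h2)).of_eq ?_ (by simp only [wBT]; omega)
  rw [tdSt_eq, e1, e2]

end TDrive

/-- The slice constraints of the empty blocks contribute no clauses. [folklore] -/
theorem flatMap_theta_range_numBlocks (P : Params) (F : List (List (ℕ × Bool))) :
    ((List.range (numBlocks P F)).flatMap fun i => cnf (theta P F i) (depTheta P F i)) =
      (List.range (numNB P F)).flatMap fun i => cnf (theta P F i) (depTheta P F i) := by
  have key : ∀ n, numNB P F ≤ n → ((List.range n).flatMap fun i => cnf (theta P F i) (depTheta P F i)) =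
      (List.range (numNB P F)).flatMap fun i => cnf (theta P F i) (depTheta P F i) := by
    intro n hn
    induction n, hn using Nat.le_induction with
    | base => rfl
    | succ n hn ih =>
      rw [List.range_succ, List.flatMap_append, ih]
      have hb : block P F n = [] := block_eq_nil_of_numNB_le P F hn
      have hdep : depTheta P F n = [] := by simp [depTheta, hb]
      have hth : ∀ w, theta P F n w = true := fun w => by simp [theta, hb, fAt]
      simp [hdep, cnf, hth]
  exact key _ (numNB_le_numBlocks P F)

/-! ### All clauses of the reduced formula -/

/-- **Emit the clauses of `IPRename.reduce P φ`**: the substituted clauses, then the slice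
constraints. [folklore] -/
def emitOut : RProg := clauseDrive ;; thetaDrive

/-- The cost of `emitOut`. [folklore] -/
def emitOutCost (P : Params) (F : List (List (ℕ × Bool))) : ℕ :=
  (10 * (wAC P F).length + 3 + (F.map (clauseCost P F)).sum + 1) +
  (10 * (wBT (btab P F)).length + 3 + (((List.range (numNB P F)).map (thetaCost P F)).sum + 2 * (wBT (btab P F)).length + 1) +
    (2 * numNB P F + 1))

/-- What `emitOut` needs of the work registers. [folklore] -/
structure EmitBase (T : AStore Γ' KR) (P : Params) (F : List (List (ℕ × Bool))) : Prop where
  /-- the evaluator's needs -/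
  kb : KBase T (btab P F) (ytab P F)
  /-- the scan's registers -/
  sc : ScanClean T
  /-- the current clause -/
  cl : T KR.cl = []
  /-- the staging register -/
  c2 : T KR.c2 = []
  /-- scratch -/
  u1 : T KR.u1 = []
  /-- scratch -/
  fl2 : T KR.fl2 = []
  /-- scratch -/
  fl3 : T KR.fl3 = []
  /-- the block index -/
  iu : T KR.iu = []
  /-- the loop copy of the block table -/
  s0 : T KR.s0 = []
  /-- the loop copy of the annotated clauses -/
  ac2 : T KR.ac2 = []
  /-- the annotated clauses -/
  ac : T KR.ac = wAC P F

/-- **Specification of `emitOut`**: the word of `outClauses P F` is pushed reversed onto the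
accumulator, everything else is restored. [folklore] -/
theorem runs_emitOut (P : Params) (F : List (List (ℕ × Bool))) (T : AStore Γ' KR) (hE : EmitBase T P F) (acc : List Γ') :
    Runs emitOut (Sum.elim (tbSt [] acc [] [] [] [] []) T)
      (Sum.elim (tbSt [] ((wFam (outClauses P F)).reverse ++ acc) [] [] [] [] []) T) (emitOutCost P F) := by
  unfold emitOut
  have h1 := runs_clauseDrive P F T ⟨hE.kb, hE.sc, hE.cl, hE.c2⟩ hE.ac hE.ac2 acc
  have h2 := runs_thetaDrive P F T ⟨hE.kb, hE.sc, hE.u1, hE.fl2, hE.fl3⟩ hE.iu hE.s0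
    ((wFam (F.flatMap fun c => cnf (gClause P F c) (depClause P F c))).reverse ++ acc)
  refine (h1.seq h2).of_eq ?_ (by rfl)
  rw [outClauses, flatMap_theta_range_numBlocks, wFam_append, List.reverse_append, List.append_assoc]

end Literature.Computability.FineGrained.IPRenameM
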